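import Summits.HubbardSuperconductivity.HubbardSuperconductivity.Theorems.AnisotropyChordTransferFibre3FinMHoleL13a
import Summits.HubbardSuperconductivity.HubbardSuperconductivity.Theorems.AnisotropyChordTransferFibre3FinMHoleL13b
import Summits.HubbardSuperconductivity.HubbardSuperconductivity.Theorems.AnisotropyChordTransferFibre3FinMHoleL13c
import Summits.HubbardSuperconductivity.HubbardSuperconductivity.Theorems.AnisotropyChordTransferFibre3FinMHoleL13d
import Summits.HubbardSuperconductivity.HubbardSuperconductivity.Theorems.AnisotropyChordTransferFibre3FinMHoleL13e

/-!
# Route `AnisotropyChord` / H0 rotor rung: ★ the regime clause `mHole ≥ 0` at `L = 13` for EVERY ground profile (FIN-class, kernel-certified)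

`mHole_nonneg_thirteen`: for every `0 < Δ < 1` and every ground two-magnon profile `f` at `L = 13`, `0 ≤ mHole 13 Δ f`, i.e.
`T⁺ ≤ ε₁(1 − 5/V + 6/V²)/2` — the first half of the regime clause of the GM₃ assembly `gm3_allL` at this `L`, by the FIN
evaluator in convolution form (`…FinConvCell`, soundness `…FinMHoleConv.mHole_nonneg_of_cells3`, kernel facts `…FinMHoleL13*`).
Prover seat `hubbard-h0-rotor-p3` g4; helper for stmt-HubbardSuperconductivity-23918 (piece A of rung 19089; `--supports`, helper class).
WHAT THIS IS NOT: nothing here proves superconductivity in the Hubbard model (rotor TARGET as worded stays FALSE, g15 verdict); one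
hypothesis of ONE conditional reduction at one `L`; the three β-free cruxes and the side condition remain. Tree imports only; no sorry.
-/

set_option linter.dupNamespace false
set_option autoImplicit false

namespace Summit.HubbardSuperconductivity.HubbardSuperconductivity.Theorems.AnisotropyChord.Transfer.Fibre3

namespace FinCell

/-- the cell list at `L = 13` (12 points in units of `2^60`, from `0` to `≥ lamTop 13`) passes cellwise. [folklore] -/
theorem cellsAll_thirteen : cellsAll (mholeCellOK3 13) [0, 661187074910210, 1719086394766547, 3411725306536686, 6119947565368908, 8286525372434686, 10019787618087308, 12793007211131504, 15011582885566860, 18561303964663432, 24240857691217948, 26447482996408416] = true := by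
  simp only [cellsAll, cell13_1, cell13_2, cell13_3, cell13_4, cell13_5, cell13_6, cell13_7, cell13_8, cell13_9, cell13_10, cell13_11, Bool.true_and]

/-- kernel fact: the cell list at `L = 13` is a certificate (`mholeCheck3`): head `0`, length, `lamTop 13 ≤` last point, all cells. [folklore] -/
theorem mholeCheck3_thirteen : mholeCheck3 13 [0, 661187074910210, 1719086394766547, 3411725306536686, 6119947565368908, 8286525372434686, 10019787618087308, 12793007211131504, 15011582885566860, 18561303964663432, 24240857691217948, 26447482996408416] = true := by
  unfold mholeCheck3
  rw [cellsAll_thirteen]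
  decide +kernel

end FinCell

/-- ★★ THE REGIME CLAUSE `mHole ≥ 0` AT `L = 13`: every ground two-magnon profile at `L = 13`, `0 < Δ < 1`, has
`T⁺ ≤ ε₁(1 − 5/V + 6/V²)/2` (FIN-class, kernel-certified with zero data). [folklore] -/
theorem mHole_nonneg_thirteen {Δ : ℝ} (hΔ0 : 0 < Δ) (hΔ1 : Δ < 1) :
    ∀ lam2 : ℝ, ∀ f : Tor 13 → ℝ, IsGroundTwoMagnon 13 Δ lam2 f → 0 ≤ mHole 13 Δ f :=
  FinCell.mHole_nonneg_of_cells3 13 (by norm_num) [0, 661187074910210, 1719086394766547, 3411725306536686, 6119947565368908, 8286525372434686, 10019787618087308, 12793007211131504, 15011582885566860, 18561303964663432, 24240857691217948, 26447482996408416] FinCell.mholeCheck3_thirteen hΔ0 hΔ1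

end Summit.HubbardSuperconductivity.HubbardSuperconductivity.Theorems.AnisotropyChord.Transfer.Fibre3
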